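import Summits.Langlands.Langlands.Theses.EvenSkinnerWilesMirror
import Literature.NumberTheory.Automorphic.TunnellOctahedralGlobal

/-!
# Skeleton line `mirror-descent-parity` for crux stmt-Langlands-15309 `BianchiMirrorParity`
# (route Langlands/EvenSkinnerWilesMirror) — crux-strategist `cstrat-stmt-Langlands-15309-r1`

The crux (THE LEVER of the route): `K` imaginary quadratic, `ρ : Γ_ℚ → GL₂(ℚ̄_p)` a.e. unramified with
`ρ|_{Γ_K}` irreducible and `det(ρ)^N = ε^{(k-1)N}` for an EVEN `k ≥ 2`; if `ρ|_{Γ_K}` is Satake–Frobenius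
compatible at cofinitely many places with an `L`-algebraic cuspidal `π` on `GL₂(𝔸_K)`, then `ρ` is ODD.

FOUR REGISTERED STUBS = the typed decomposition X₁ … X₄ (the route's foreseen two-layer plan
"DescentToQ → CentralCharacterParity → OddFromRegularDescent", the last cut once more along the seam
external theorem / Galois lemma), and the kernel-checked composition `BianchiMirrorParity_of` which threads the
witnesses `π ↦ π₀ ↦ (T, m) ↦ r` and PROVES the parity trick in between (an `L`-algebraic rank-2 infinity type
whose two integral `a`-exponents sum to an odd integer is regular).  The same composition, with the stubs as
hypotheses, is `Cruxes/BianchiMirrorParity/SplitGlue.lean` (the glue of the prepared `route edit --split`,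
children `Cruxes/BianchiMirrorParity/children.json`).

* `stub_mirrorDescent` (X₁, M, known in print): descent of `π` to an `L`-algebraic cuspidal `π₀` on `GL₂(𝔸_ℚ)`
  with `IsWeakBaseChangeLiftAE π₀ π` — Galois-stability of the Satake data of `π` (they are Frobenius eigenvalues
  of a `Γ_ℚ`-representation) + `cuspidal_descent_cyclic` (Arthur–Clozel III.4.2 (d)) +
  `ArthurClozel1989_strongLifting_archimedean.isLAlgebraic_descent` (III.5.1, Ch. 1 §7) with the proved
  `AutomorphicRepData.hasArchParameter_unique`.
* `stub_descentWeightParity` (X₂, L, THE NORMALISATION RISK): some `L`-algebraic infinity type of `π₀` has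
  `a`-exponents summing to one ODD integer at every embedding (`= ±(k-1)`): `ι(det ρ(Frob_w)) = ω_π(ϖ_w)⁻¹`
  (arithmetic-Frobenius `L`-normalised dictionary + `AutomorphicRepData.exists_centralCharacter`),
  `ω_π^N = ‖·‖_K^{(k-1)N}` (`HeckeCharacter.ext_of_eventually_valueAtUniformizer_eq`), differential
  (`HasArchParameter.apply_scalar`) and `∑ χ_{π₀}(τ|_ℚ) = ∑ χ_π(τ)` (`sum_archParameter_eq_of_isWeakBaseChangeLiftAE`).
* `stub_regularDescentOddGaloisRep` (X₃, M/citation, DELIGNE — the one printed input the tree lacks): a cuspidal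
  `π₀` on `GL₂(𝔸_ℚ)` with a regular `L`-algebraic infinity type has an ODD Satake–Frobenius-compatible
  `r : Γ_ℚ → GL₂(ℚ̄_p)` (`π₀ = π_g ⊗ |det|^j`, `r = r_{g,ι} ⊗ ε^j`, Deligne 1971; `det r_g(c) = -1`).
* `stub_oddnessAlongMirror` (X₄, M, provable now): `r` odd, `r ↔ π₀ ↝ π ↔ ρ|_K`, `ρ|_K` irreducible ⇒ `ρ` odd
  (Frobenius charpolys of `r|_K`, `ρ|_K` agree a.e. by `hasFrobCharpolyAt_restrictField_fin_two` + Satake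
  uniqueness; Chebotarev + Brauer–Nesbitt; Clifford at index two; `det ρ(c) = det r(c) χ(c)² = -1`).

Disproof used: none exists for this crux (`Cruxes/BianchiMirrorParity/` had no Disproof.lean at registration);
the refuter's route review (evidence REVIEW-EvenSkinnerWilesMirror.md, 2026-08-16) CHECKED the normalisation:
`a₁ + a₂ = k - 1` under `Summit.Langlands.SatakeFrobCompatibleAt`, which X₂ states sign-free (`∃ m, Odd m`).
No stub restates the crux or the summit (BC2/BC3 probes `stub → BianchiMirrorParity`, `stub → Langlands` by
`first | exact? | simpa | aesop` all FAIL, folder `bc/`), none is a one-liner.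
-/

-- `Summit.Langlands.Langlands.…`: the repeated path component is the tree's layout (D-0017).
set_option linter.dupNamespace false

namespace Summit.Langlands.Langlands.Cruxes.BianchiMirrorParity.MirrorDescentParity

open Filter
open Summit.Langlands.Langlands.Theses.EvenSkinnerWilesMirror

/-- STUB X₁ `MirrorDescent` (support, M): cyclic descent of the weakly-`ρ|_K`-compatible `π` to an `L`-algebraic
cuspidal `π₀` on `GL₂(𝔸_ℚ)` with `π` a weak base change lift of `π₀`.
[cite: ArthurClozelAMS120, Ch. 3 Thm. 4.2 (d) and Thm. 5.1] -/
theorem stub_mirrorDescent : ∀ (p : ℕ) [Fact p.Prime] (K : Type) [Field K] [NumberField K], NumberField.IsTotallyComplex K → Module.finrank ℚ K = 2 → ∀ (hcpt : Literature.NumberTheory.Automorphic.isCompact_glFiniteIntegralLevel 2 K) (hℚ : Literature.NumberTheory.Automorphic.isCompact_glFiniteIntegralLevel 2 ℚ) (ι : PadicAlgCl p ≃+* ℂ) (ρ : Literature.NumberTheory.GaloisRepresentations.FramedGaloisRep ℚ (PadicAlgCl p) 2) (π : Literature.NumberTheory.Automorphic.CuspidalAutomorphicRepData 2 K hcpt),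 π.1.IsLAlgebraic → (∀ᶠ w in cofinite, Summit.Langlands.SatakeFrobCompatibleAt ι π.1 (ρ.restrictField K) w) → ∃ π₀ : Literature.NumberTheory.Automorphic.CuspidalAutomorphicRepData 2 ℚ hℚ, π₀.1.IsLAlgebraic ∧ Literature.NumberTheory.Automorphic.IsWeakBaseChangeLiftAE π₀.1 π.1 := by
  sorry

/-- STUB X₂ `DescentWeightParity` (crux, L): the `a`-exponents of an `L`-algebraic infinity type of the descent
`π₀` sum to one odd integer (`±(k-1)`) at every embedding. [cite: BuzzardGeeLMS2014, Conj. 3.2.1 and §3.1] -/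
theorem stub_descentWeightParity : ∀ (p : ℕ) [Fact p.Prime] (K : Type) [Field K] [NumberField K], NumberField.IsTotallyComplex K → Module.finrank ℚ K = 2 → ∀ (hcpt : Literature.NumberTheory.Automorphic.isCompact_glFiniteIntegralLevel 2 K) (hℚ : Literature.NumberTheory.Automorphic.isCompact_glFiniteIntegralLevel 2 ℚ) (ι : PadicAlgCl p ≃+* ℂ) (ρ : Literature.NumberTheory.GaloisRepresentations.FramedGaloisRep ℚ (PadicAlgCl p) 2) (π : Literature.NumberTheory.Automorphic.CuspidalAutomorphicRepData 2 K hcpt) (π₀ : Literature.NumberTheory.Automorphic.CuspidalAutomorphicRepData 2 ℚ hℚ), (∀ᶠ v in cofinite, ρ.IsUnramifiedAt v) → (∃ k N : ℕ, 2 ≤ k ∧ Even k ∧ 0 < N ∧ ∀ g : Field.absoluteGaloisGroup ℚ, ((Matrix.GeneralLinearGroup.det (ρ g) : (PadicAlgCl p)ˣ) : PadicAlgCl p) ^ N = algebraMap (Padic p) (PadicAlgCl p) (((Literature.NumberTheory.GaloisRepresentations.GaloisRep.cyclotomicCharacter ℚ p g).val : PadicInt p) : Padic p) ^ ((k - 1)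 * N)) → (∀ᶠ w in cofinite, Summit.Langlands.SatakeFrobCompatibleAt ι π.1 (ρ.restrictField K) w) → Literature.NumberTheory.Automorphic.IsWeakBaseChangeLiftAE π₀.1 π.1 → π₀.1.IsLAlgebraic → ∃ T : Literature.NumberTheory.Automorphic.InfinityType ℚ 2, π₀.1.HasInfinityType T ∧ T.IsLAlgebraic ∧ ∃ m : ℤ, Odd m ∧ ∀ σ : ℚ →+* ℂ, ((T σ).map Literature.NumberTheory.Automorphic.ArchWeight.a).sum = (m : ℂ) := by
  sorry

/-- STUB X₃ `RegularDescentOddGaloisRep` (crux, citation): Deligne's odd Galois representation attached to a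
cuspidal `π₀` on `GL₂(𝔸_ℚ)` with regular `L`-algebraic infinity type, in the `L`-normalised arithmetic-Frobenius
dictionary of `SatakeFrobCompatibleAt`. [cite: Deligne1971, Thm. 6.1] -/
theorem stub_regularDescentOddGaloisRep : ∀ (p : ℕ) [Fact p.Prime] (hℚ : Literature.NumberTheory.Automorphic.isCompact_glFiniteIntegralLevel 2 ℚ) (ι : PadicAlgCl p ≃+* ℂ) (π₀ : Literature.NumberTheory.Automorphic.CuspidalAutomorphicRepData 2 ℚ hℚ), (∃ T : Literature.NumberTheory.Automorphic.InfinityType ℚ 2, π₀.1.HasInfinityType T ∧ T.IsLAlgebraic ∧ T.IsRegular) → ∃ r : Literature.NumberTheory.GaloisRepresentations.FramedGaloisRep ℚ (PadicAlgCl p) 2, r.IsOdd ∧ ∀ᶠ v in cofinite, Summit.Langlands.SatakeFrobCompatibleAt ι π₀.1 r v := by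
  sorry

/-- STUB X₄ `OddnessAlongMirror` (support, M): oddness passes from `r` to `ρ` along `r ↔ π₀ ↝ π ↔ ρ|_K` when
`ρ|_K` is irreducible (Chebotarev, Brauer–Nesbitt, Clifford). [folklore] -/
theorem stub_oddnessAlongMirror : ∀ (p : ℕ) [Fact p.Prime] (K : Type) [Field K] [NumberField K], NumberField.IsTotallyComplex K → Module.finrank ℚ K = 2 → ∀ (hcpt : Literature.NumberTheory.Automorphic.isCompact_glFiniteIntegralLevel 2 K) (hℚ : Literature.NumberTheory.Automorphic.isCompact_glFiniteIntegralLevel 2 ℚ) (ι : PadicAlgCl p ≃+* ℂ) (ρ r : Literature.NumberTheory.GaloisRepresentations.FramedGaloisRep ℚ (PadicAlgCl p) 2) (π : Literature.NumberTheory.Automorphic.CuspidalAutomorphicRepData 2 K hcpt) (π₀ : Literature.NumberTheory.Automorphic.CuspidalAutomorphicRepData 2 ℚ hℚ), (ρ.restrictField K).toGaloisRep.IsIrreducible → r.IsOdd → (∀ᶠ w in cofinite, Summit.Langlands.SatakeFrobCompatibleAt ι π.1 (ρ.restrictField K) w) → Literature.NumberTheory.Automorphic.IsWeakBaseChangeLiftAE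 π₀.1 π.1 → (∀ᶠ v in cofinite, Summit.Langlands.SatakeFrobCompatibleAt ι π₀.1 r v) → ρ.IsOdd := by
  sorry

/-- Two integers with odd sum are distinct, read on a `2`-element multiset of complex numbers all of whose members
are integers. [folklore] -/
theorem nodup_of_card_two_of_int_of_odd_sum {s : Multiset ℂ} (hcard : Multiset.card s = 2)
    (hint : ∀ x ∈ s, ∃ k : ℤ, x = k) {m : ℤ} (hm : Odd m) (hsum : s.sum = (m : ℂ)) : s.Nodup := by
  obtain ⟨x, y, rfl⟩ := Multiset.card_eq_two.mp hcard
  obtain ⟨kx, hkx⟩ := hint x (by simp)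
  obtain ⟨ky, hky⟩ := hint y (by simp)
  have hs : x + y = (m : ℂ) := by simpa using hsum
  rw [hkx, hky] at hs
  have hk : kx + ky = m := by exact_mod_cast hs
  refine Multiset.nodup_cons.mpr ⟨?_, Multiset.nodup_singleton _⟩
  intro hmem
  rw [Multiset.mem_singleton, hkx, hky] at hmem
  have hxy : kx = ky := by exact_mod_cast hmem
  subst hxy
  exact (Int.not_even_iff_odd.mpr hm) ⟨kx, hk.symm⟩

/-- **The parity trick**: an `L`-algebraic rank-`2` infinity type over `ℚ` whose `a`-exponents sum, at every
embedding, to an odd integer is regular. [folklore] -/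
theorem isRegular_of_isLAlgebraic_of_odd_sum {T : Literature.NumberTheory.Automorphic.InfinityType ℚ 2}
    (hwf : T.IsWellFormed) (hL : T.IsLAlgebraic) {m : ℤ} (hm : Odd m)
    (hsum : ∀ σ : ℚ →+* ℂ, ((T σ).map Literature.NumberTheory.Automorphic.ArchWeight.a).sum = (m : ℂ)) :
    T.IsRegular := by
  intro σ
  refine nodup_of_card_two_of_int_of_odd_sum ?_ ?_ hm (hsum σ)
  · rw [Multiset.card_map, hwf.1 σ]
  · intro x hx
    obtain ⟨q, hq, rfl⟩ := Multiset.mem_map.mp hx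
    obtain ⟨k, l, hk, -⟩ := hL σ q hq
    exact ⟨k, hk⟩

/-- **COMPOSITION (kernel-checked, no sorry): the four stubs imply the crux BY NAME.**  Fix the data of
`BianchiMirrorParity` and its witness `π`; descend (X₁); read the odd weight parity (X₂) and convert it into
regularity (`isRegular_of_isLAlgebraic_of_odd_sum`); attach Deligne's odd `r` (X₃); transport oddness (X₄). [folklore] -/
theorem BianchiMirrorParity_of :
    (∀ (p : ℕ) [Fact p.Prime] (K : Type) [Field K] [NumberField K], NumberField.IsTotallyComplex K → Module.finrank ℚ K = 2 → ∀ (hcpt : Literature.NumberTheory.Automorphic.isCompact_glFiniteIntegralLevel 2 K) (hℚ : Literature.NumberTheory.Automorphic.isCompact_glFiniteIntegralLevel 2 ℚ) (ι : PadicAlgCl p ≃+* ℂ) (ρ : Literature.NumberTheory.GaloisRepresentations.FramedGaloisRep ℚ (PadicAlgCl p) 2) (π : Literature.NumberTheory.Automorphic.CuspidalAutomorphicRepData 2 K hcpt), π.1.IsLAlgebraic → (∀ᶠ w in cofinite, Summit.Langlands.SatakeFrobCompatibleAt ι π.1 (ρ.restrictField K) w) → ∃ π₀ : Literature.NumberTheory.Automorphic.CuspidalAutomorphicRepData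 2 ℚ hℚ, π₀.1.IsLAlgebraic ∧ Literature.NumberTheory.Automorphic.IsWeakBaseChangeLiftAE π₀.1 π.1) →
    (∀ (p : ℕ) [Fact p.Prime] (K : Type) [Field K] [NumberField K], NumberField.IsTotallyComplex K → Module.finrank ℚ K = 2 → ∀ (hcpt : Literature.NumberTheory.Automorphic.isCompact_glFiniteIntegralLevel 2 K) (hℚ : Literature.NumberTheory.Automorphic.isCompact_glFiniteIntegralLevel 2 ℚ) (ι : PadicAlgCl p ≃+* ℂ) (ρ : Literature.NumberTheory.GaloisRepresentations.FramedGaloisRep ℚ (PadicAlgCl p) 2) (π : Literature.NumberTheory.Automorphic.CuspidalAutomorphicRepData 2 K hcpt) (π₀ : Literature.NumberTheory.Automorphic.CuspidalAutomorphicRepData 2 ℚ hℚ), (∀ᶠ v in cofinite, ρ.IsUnramifiedAt v) → (∃ k N : ℕ, 2 ≤ k ∧ Even k ∧ 0 < N ∧ ∀ g : Field.absoluteGaloisGroup ℚ, ((Matrix.GeneralLinearGroup.det (ρ g) : (PadicAlgCl p)ˣ) : PadicAlgCl p) ^ N = algebraMap (Padic p) (PadicAlgCl p) (((Literature.NumberTheory.GaloisRepresentations.GaloisRep.cyclotomicCharacter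 ℚ p g).val : PadicInt p) : Padic p) ^ ((k - 1) * N)) → (∀ᶠ w in cofinite, Summit.Langlands.SatakeFrobCompatibleAt ι π.1 (ρ.restrictField K) w) → Literature.NumberTheory.Automorphic.IsWeakBaseChangeLiftAE π₀.1 π.1 → π₀.1.IsLAlgebraic → ∃ T : Literature.NumberTheory.Automorphic.InfinityType ℚ 2, π₀.1.HasInfinityType T ∧ T.IsLAlgebraic ∧ ∃ m : ℤ, Odd m ∧ ∀ σ : ℚ →+* ℂ, ((T σ).map Literature.NumberTheory.Automorphic.ArchWeight.a).sum = (m : ℂ)) →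
    (∀ (p : ℕ) [Fact p.Prime] (hℚ : Literature.NumberTheory.Automorphic.isCompact_glFiniteIntegralLevel 2 ℚ) (ι : PadicAlgCl p ≃+* ℂ) (π₀ : Literature.NumberTheory.Automorphic.CuspidalAutomorphicRepData 2 ℚ hℚ), (∃ T : Literature.NumberTheory.Automorphic.InfinityType ℚ 2, π₀.1.HasInfinityType T ∧ T.IsLAlgebraic ∧ T.IsRegular) → ∃ r : Literature.NumberTheory.GaloisRepresentations.FramedGaloisRep ℚ (PadicAlgCl p) 2, r.IsOdd ∧ ∀ᶠ v in cofinite, Summit.Langlands.SatakeFrobCompatibleAt ι π₀.1 r v) →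
    (∀ (p : ℕ) [Fact p.Prime] (K : Type) [Field K] [NumberField K], NumberField.IsTotallyComplex K → Module.finrank ℚ K = 2 → ∀ (hcpt : Literature.NumberTheory.Automorphic.isCompact_glFiniteIntegralLevel 2 K) (hℚ : Literature.NumberTheory.Automorphic.isCompact_glFiniteIntegralLevel 2 ℚ) (ι : PadicAlgCl p ≃+* ℂ) (ρ r : Literature.NumberTheory.GaloisRepresentations.FramedGaloisRep ℚ (PadicAlgCl p) 2) (π : Literature.NumberTheory.Automorphic.CuspidalAutomorphicRepData 2 K hcpt) (π₀ : Literature.NumberTheory.Automorphic.CuspidalAutomorphicRepData 2 ℚ hℚ), (ρ.restrictField K).toGaloisRep.IsIrreducible → r.IsOdd → (∀ᶠ w in cofinite, Summit.Langlands.SatakeFrobCompatibleAt ι π.1 (ρ.restrictField K) w) → Literature.NumberTheory.Automorphic.IsWeakBaseChangeLiftAE π₀.1 π.1 → (∀ᶠ v in cofinite, Summit.Langlands.SatakeFrobCompatibleAt ι π₀.1 r v) → ρ.IsOdd) →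
      Summit.Langlands.Langlands.Theses.EvenSkinnerWilesMirror.BianchiMirrorParity := by
  intro h1 h2 h3 h4
  intro p _ K _ _ hKc hK2 hcpt ι ρ hirr hunr hdet hmod
  obtain ⟨π, hπL, hπsat⟩ := hmod
  have hℚ : Literature.NumberTheory.Automorphic.isCompact_glFiniteIntegralLevel 2 ℚ :=
    Literature.NumberTheory.Automorphic.isCompact_glFiniteIntegralLevel_holds 2 ℚ
  obtain ⟨π₀, hπ₀L, hBC⟩ := h1 p K hKc hK2 hcpt hℚ ι ρ π hπL hπsat
  obtain ⟨T, hT, hTL, m, hm, hsum⟩ := h2 p K hKc hK2 hcpt hℚ ι ρ π π₀ hunr hdet hπsat hBC hπ₀L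
  have hreg : T.IsRegular := isRegular_of_isLAlgebraic_of_odd_sum hT.1 hTL hm hsum
  obtain ⟨r, hrodd, hrsat⟩ := h3 p hℚ ι π₀ ⟨T, hT, hTL, hreg⟩
  exact h4 p K hKc hK2 hcpt hℚ ι ρ r π π₀ hirr hrodd hπsat hBC hrsat

/-- The crux itself, from the registered stubs (so that the line closes the item the moment the four stubs do).
[folklore] -/
theorem bianchiMirrorParity_of_stubs :
    Summit.Langlands.Langlands.Theses.EvenSkinnerWilesMirror.BianchiMirrorParity :=
  BianchiMirrorParity_of stub_mirrorDescent stub_descentWeightParity stub_regularDescentOddGaloisRep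
    stub_oddnessAlongMirror

end Summit.Langlands.Langlands.Cruxes.BianchiMirrorParity.MirrorDescentParity
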